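import Summits.Ventures.HodgeRepro2.T5SU11ResolventGroundStateSharpness
import Summits.Ventures.HodgeRepro2.T5SU11WeightedSpaceGroundStateIterateDiff
import Summits.Ventures.HodgeRepro2.T5SU11ResolventIterateDerivative
import Summits.Ventures.HodgeRepro2.T5SU11ResolventIteratedDerivative

/-!
# Summary XIX — the exact constant `1/(λ − 1)²`, and the iterates of the resolvent as analytic functions of the spectral
parameter on `W_1` (rows 567–570), under uniform names

Throughout `μ = λ(λ − 2)`, `λ(μ) = 1 + √(μ + 1)`, `Ξ = φ_1`, `W_1 = {g continuous on (0, ∞) : |g| ≤ D Ξ}`,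
`m = min((λ − 1)², (λ₂ − 1)²)`.

* `transform_ground_l1` — **`∫ (G^I_λ g) Ξ sinh 2t = −(∫ g Ξ sinh 2s)/(λ − 1)²`** on `L¹(Ξ sinh 2t dt) ∩ class` (row 567);
* `l1_norm_exact_ground`, `linfty_norm_exact_ground` — **the `L¹(Ξ sinh)` norm is attained on every non-negative source,
  the `W_1` norm on `Ξ`: both are exactly `1/(λ − 1)²`** (row 567);
* `resolvent_add_ground`, `resolvent_sub_ground` — linearity on `W_1` (row 568);
* `iterate_diff_recursion`, `iterate_lipschitz_lam`, `iterate_continuous_lam` — **the difference recursion of the iterates,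
  `|(G^I_λ)ⁿ g − (G^I_{λ₂})ⁿ g| ≤ |μ − μ₂| n D Ξ/m^{n+1}`, continuity in `λ`** (row 568);
* `iterate_taylor_remainder`, `iterate_hasDerivAt_lam`, `iterate_deriv_lam` — **the second-order remainder and
  `d/dλ (G^I_λ)ⁿ g(t) = (2λ − 2) n (G^I_λ)^{n+1} g(t)`** (row 569);
* `iterate_hasDerivAt_mu`, `resolvent_iteratedDeriv_mu`, `resolvent_iteratedDeriv_mu'` — **`d/dμ (L − μ)^{−n} =
  n (L − μ)^{−n−1}` and `dᵏ/dμᵏ (L − μ)⁻¹ g = k! (L − μ)^{−k−1} g`** (row 570).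

Nothing is claimed about (N).

Blind lane: Mathlib + the HodgeRepro2 prefix only; no sorry; axioms ⊆ {propext, Classical.choice,
Quot.sound}.
-/

namespace Summit.Ventures.HodgeRepro2.T5SU11RadialSummaryXIX

open Filter Topology MeasureTheory
open Set (Ioi Ioc)
open T5SU11Cartan T5SU11SphericalFunction T5SU11SphericalDecay T5SU11RadialGreenImproper
  T5SU11ResolventGroundStateSharpness T5SU11WeightedSpaceGroundStateIterateDiff T5SU11ResolventIterateDerivative
  T5SU11ResolventIteratedDerivative

section measure

variable [MeasurableSpace Circle] [BorelSpace Circle]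

variable {lam : ℝ} (hlam : 1 < lam) {g : ℝ → ℝ} (hg : ContinuousOn g (Ioi 0))

include hlam hg in
/-- **The ground-state transform of the resolvent on `L¹(Ξ sinh 2t dt)`** (row 567). -/
theorem transform_ground_l1 {M : ℝ} (hM : ∀ s ∈ Ioc (0 : ℝ) 1, |g s| ≤ M) (hM0 : 0 ≤ M)
    {ε C s₀ : ℝ} (hε : 2 - lam < ε) (hC : ∀ s, s₀ ≤ s → |g s| ≤ C * Real.exp (-ε * s))
    (hg1 : IntegrableOn (fun s => |g s| * sph 1 (hyp s) * Real.sinh (2 * s)) (Ioi 0)) :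
    ∫ t in Ioi 0, greenSolI (fun t => sph lam (hyp t)) (sphDecay lam) g t * sph 1 (hyp t) * Real.sinh (2 * t)
      = -(∫ s in Ioi 0, g s * sph 1 (hyp s) * Real.sinh (2 * s)) / (lam - 1) ^ 2 :=
  transform_greenSolI_one_of_integrable hlam hg hM hM0 hε hC hg1

include hlam hg in
/-- **The `L¹(Ξ sinh 2t dt)` norm of the resolvent is exactly `1/(λ − 1)²`** — attained on non-negative sources (row 567). -/
theorem l1_norm_exact_ground {M : ℝ} (hM : ∀ s ∈ Ioc (0 : ℝ) 1, |g s| ≤ M) (hM0 : 0 ≤ M)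
    {ε C s₀ : ℝ} (hε : 2 - lam < ε) (hC : ∀ s, s₀ ≤ s → |g s| ≤ C * Real.exp (-ε * s))
    (hg1 : IntegrableOn (fun s => |g s| * sph 1 (hyp s) * Real.sinh (2 * s)) (Ioi 0)) (hg0 : ∀ s, 0 < s → 0 ≤ g s) :
    ∫ t in Ioi 0, |greenSolI (fun t => sph lam (hyp t)) (sphDecay lam) g t| * sph 1 (hyp t) * Real.sinh (2 * t)
      = (∫ s in Ioi 0, |g s| * sph 1 (hyp s) * Real.sinh (2 * s)) / (lam - 1) ^ 2 :=
  integral_abs_greenSolI_mul_sph_one_eq_of_nonneg hlam hg hM hM0 hε hC hg1 hg0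

include hlam in
/-- **The `W_1` norm of the resolvent is exactly `1/(λ − 1)²`** — attained on `Ξ` (row 567). -/
theorem linfty_norm_exact_ground {t : ℝ} (ht : 0 < t) :
    |greenSolI (fun t => sph lam (hyp t)) (sphDecay lam) (fun s => sph 1 (hyp s)) t| = sph 1 (hyp t) / (lam - 1) ^ 2 :=
  abs_greenSolI_sph_one_eq hlam ht

include hlam in
/-- **`G^I_λ (g₁ + g₂) = G^I_λ g₁ + G^I_λ g₂`** on `W_1` (row 568). -/
theorem resolvent_add_ground {g₁ g₂ : ℝ → ℝ} (hg₁ : ContinuousOn g₁ (Ioi 0)) (hg₂ : ContinuousOn g₂ (Ioi 0))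
    {D₁ D₂ : ℝ} (hD₁ : ∀ s, 0 < s → |g₁ s| ≤ D₁ * sph 1 (hyp s)) (hD₂ : ∀ s, 0 < s → |g₂ s| ≤ D₂ * sph 1 (hyp s))
    {t : ℝ} (ht : 0 < t) :
    greenSolI (fun t => sph lam (hyp t)) (sphDecay lam) (fun s => g₁ s + g₂ s) t
      = greenSolI (fun t => sph lam (hyp t)) (sphDecay lam) g₁ t
        + greenSolI (fun t => sph lam (hyp t)) (sphDecay lam) g₂ t :=
  greenSolI_add_ground hlam hg₁ hg₂ hD₁ hD₂ ht

include hlam in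
/-- **`G^I_λ (g₁ − g₂) = G^I_λ g₁ − G^I_λ g₂`** on `W_1` (row 568). -/
theorem resolvent_sub_ground {g₁ g₂ : ℝ → ℝ} (hg₁ : ContinuousOn g₁ (Ioi 0)) (hg₂ : ContinuousOn g₂ (Ioi 0))
    {D₁ D₂ : ℝ} (hD₁ : ∀ s, 0 < s → |g₁ s| ≤ D₁ * sph 1 (hyp s)) (hD₂ : ∀ s, 0 < s → |g₂ s| ≤ D₂ * sph 1 (hyp s))
    {t : ℝ} (ht : 0 < t) :
    greenSolI (fun t => sph lam (hyp t)) (sphDecay lam) (fun s => g₁ s - g₂ s) t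
      = greenSolI (fun t => sph lam (hyp t)) (sphDecay lam) g₁ t
        - greenSolI (fun t => sph lam (hyp t)) (sphDecay lam) g₂ t :=
  greenSolI_sub_ground hlam hg₁ hg₂ hD₁ hD₂ ht

variable {D : ℝ} (hD : ∀ s, 0 < s → |g s| ≤ D * sph 1 (hyp s))

include hlam hg hD in
/-- **The difference recursion of the iterates** (row 568). -/
theorem iterate_diff_recursion {lam₂ : ℝ} (hlam₂ : 1 < lam₂) (n : ℕ) {t : ℝ} (ht : 0 < t) :
    ((greenSolI (fun t => sph lam (hyp t)) (sphDecay lam))^[n + 1] g) t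
        - ((greenSolI (fun t => sph lam₂ (hyp t)) (sphDecay lam₂))^[n + 1] g) t
      = greenSolI (fun t => sph lam (hyp t)) (sphDecay lam)
          (fun s => ((greenSolI (fun t => sph lam (hyp t)) (sphDecay lam))^[n] g) s
            - ((greenSolI (fun t => sph lam₂ (hyp t)) (sphDecay lam₂))^[n] g) s) t
        + (lam * (lam - 2) - lam₂ * (lam₂ - 2)) * greenSolI (fun t => sph lam (hyp t)) (sphDecay lam)
          ((greenSolI (fun t => sph lam₂ (hyp t)) (sphDecay lam₂))^[n + 1] g) t :=
  iterate_sub_succ hlam hlam₂ hg hD n ht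

include hlam hg hD in
/-- **The iterates are Lipschitz in `μ` in the `Ξ`-weighted sup-norm** (row 568). -/
theorem iterate_lipschitz_lam {lam₂ : ℝ} (hlam₂ : 1 < lam₂) (n : ℕ) {t : ℝ} (ht : 0 < t) :
    |((greenSolI (fun t => sph lam (hyp t)) (sphDecay lam))^[n] g) t
        - ((greenSolI (fun t => sph lam₂ (hyp t)) (sphDecay lam₂))^[n] g) t|
      ≤ |lam * (lam - 2) - lam₂ * (lam₂ - 2)| * (n * D * sph 1 (hyp t)
        / (min ((lam - 1) ^ 2) ((lam₂ - 1) ^ 2)) ^ (n + 1)) :=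
  abs_iterate_sub_le hlam hlam₂ hg hD n ht

include hlam hg hD in
/-- **`λ ↦ (G^I_λ)ⁿ g(t)` is continuous at every `λ > 1`** (row 568). -/
theorem iterate_continuous_lam (n : ℕ) {t : ℝ} (ht : 0 < t) :
    Tendsto (fun l => ((greenSolI (fun t => sph l (hyp t)) (sphDecay l))^[n] g) t) (𝓝 lam)
      (𝓝 (((greenSolI (fun t => sph lam (hyp t)) (sphDecay lam))^[n] g) t)) :=
  tendsto_iterate_lam hlam hg hD n ht

include hlam hg hD in
/-- **The second-order remainder of the iterates** (row 569). -/
theorem iterate_taylor_remainder {lam₂ : ℝ} (hlam₂ : 1 < lam₂) (n : ℕ) {t : ℝ} (ht : 0 < t) :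
    |(((greenSolI (fun t => sph lam (hyp t)) (sphDecay lam))^[n] g) t
        - ((greenSolI (fun t => sph lam₂ (hyp t)) (sphDecay lam₂))^[n] g) t)
        - (lam * (lam - 2) - lam₂ * (lam₂ - 2))
          * (n * ((greenSolI (fun t => sph lam₂ (hyp t)) (sphDecay lam₂))^[n + 1] g) t)|
      ≤ (lam * (lam - 2) - lam₂ * (lam₂ - 2)) ^ 2 * ((n * (n + 1) / 2) * D * sph 1 (hyp t)
        / (min ((lam - 1) ^ 2) ((lam₂ - 1) ^ 2)) ^ (n + 2)) :=
  abs_iterate_sub_sub_le hlam hlam₂ hg hD n ht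

include hlam hg hD in
/-- **`d/dλ (G^I_λ)ⁿ g(t) = (2λ − 2) n (G^I_λ)^{n+1} g(t)`** (row 569). -/
theorem iterate_hasDerivAt_lam (n : ℕ) {t : ℝ} (ht : 0 < t) :
    HasDerivAt (fun l => ((greenSolI (fun t => sph l (hyp t)) (sphDecay l))^[n] g) t)
      ((2 * lam - 2) * (n * ((greenSolI (fun t => sph lam (hyp t)) (sphDecay lam))^[n + 1] g) t)) lam :=
  hasDerivAt_iterate_lam hlam hg hD n ht

include hlam hg hD in
/-- **`deriv (λ ↦ (G^I_λ)ⁿ g(t)) λ = (2λ − 2) n (G^I_λ)^{n+1} g(t)`** (row 569). -/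
theorem iterate_deriv_lam (n : ℕ) {t : ℝ} (ht : 0 < t) :
    deriv (fun l => ((greenSolI (fun t => sph l (hyp t)) (sphDecay l))^[n] g) t) lam
      = (2 * lam - 2) * (n * ((greenSolI (fun t => sph lam (hyp t)) (sphDecay lam))^[n + 1] g) t) :=
  deriv_iterate_lam hlam hg hD n ht

include hg hD in
/-- **`d/dμ (L − μ)^{−n} g = n (L − μ)^{−n−1} g`** on `W_1` (row 570). -/
theorem iterate_hasDerivAt_mu (n : ℕ) {μ₂ : ℝ} (hμ₂ : -1 < μ₂) {t : ℝ} (ht : 0 < t) :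
    HasDerivAt (fun μ => ((greenSolI (fun t => sph (1 + Real.sqrt (μ + 1)) (hyp t))
        (sphDecay (1 + Real.sqrt (μ + 1))))^[n] g) t)
      (n * ((greenSolI (fun t => sph (1 + Real.sqrt (μ₂ + 1)) (hyp t))
        (sphDecay (1 + Real.sqrt (μ₂ + 1))))^[n + 1] g) t) μ₂ :=
  hasDerivAt_iterate_mu hg hD n hμ₂ ht

include hg hD in
/-- **`dᵏ/dμᵏ (L − μ)⁻¹ g = k! (L − μ)^{−k−1} g`** on `W_1` (row 570). -/
theorem resolvent_iteratedDeriv_mu (k : ℕ) {μ₂ : ℝ} (hμ₂ : -1 < μ₂) {t : ℝ} (ht : 0 < t) :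
    iteratedDeriv k (fun μ => greenSolI (fun t => sph (1 + Real.sqrt (μ + 1)) (hyp t))
        (sphDecay (1 + Real.sqrt (μ + 1))) g t) μ₂
      = (k.factorial : ℝ) * ((greenSolI (fun t => sph (1 + Real.sqrt (μ₂ + 1)) (hyp t))
        (sphDecay (1 + Real.sqrt (μ₂ + 1))))^[k + 1] g) t :=
  iteratedDeriv_resolvent_mu hg hD k hμ₂ ht

include hlam hg hD in
/-- **`dᵏ/dμᵏ (L − μ)⁻¹ g = k! (L − μ)^{−k−1} g` at `μ = λ(λ − 2)`** (row 570). -/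
theorem resolvent_iteratedDeriv_mu' (k : ℕ) {t : ℝ} (ht : 0 < t) :
    iteratedDeriv k (fun μ => greenSolI (fun t => sph (1 + Real.sqrt (μ + 1)) (hyp t))
        (sphDecay (1 + Real.sqrt (μ + 1))) g t) (lam * (lam - 2))
      = (k.factorial : ℝ) * ((greenSolI (fun t => sph lam (hyp t)) (sphDecay lam))^[k + 1] g) t :=
  iteratedDeriv_resolvent_mu' hg hD k hlam ht

end measure

end Summit.Ventures.HodgeRepro2.T5SU11RadialSummaryXIX
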